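import Literature.Probability.LatticeModels.LatticeSineGordon
import Literature.MathematicalPhysics.QuantumFieldTheory.GaussianToolkit
import Summits.QuantumFields.YangMills.Theorems.SmallCircleAnchorAnchorGapStubDebyeScreening3
import Summits.QuantumFields.YangMills.Theorems.SmallCircleAnchorAnchorGapStubDebyeScreening5

/-!
# Crux `AnchorGap` (stmt-QuantumFields-11141), line `registered` — the Debye–Hückel reference Gaussian (step M-a under stub DSred)

The Brydges-type expansion behind stub DSred (`stub_debyeScreening`; remaining core: clustering in
the flat reference ensemble, `stub_debyeScreening_of_flat`) is organised around the Debye–Hückel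
Gaussian: the quadratic part of `−log weight` at the sector minimum of the `k`-component lattice
sine-Gordon gas (`Literature.Probability.LatticeModels.LatticeSineGordon`) is `½ φᵀPφ` with the
precision matrix

  `P = g⁻² [(−Δ_N + ε) ⊗ 1_k + 1 ⊗ B]`  on `(ℤ/N)^d × Fin k`,  `B = 2ζg² Σ_r α_r α_rᵀ`

(written out below with Kronecker deltas; no definition is introduced).  This file identifies that
Gaussian and its covariance, for any symmetric mass matrix `B` with `wᵀBw ≥ b₀|w|²`, `b₀ > 0`
(`debyeForm_pos` supplies `b₀ = 2ζg²a(α)` for spanning charges):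

* `dhMatrix_mulVec`, `dhMatrix_form` — `(Pφ)(x,a)` and `φᵀPφ = 2 S_Gauss(φ) + g⁻² Σ_x φ_xᵀ B φ_x`
  (`gaussianAction_eq_quadraticForm`);
* `dhMatrix_posDef` — `P` is symmetric positive definite (`debyeOp_coercive`);
* `dhMatrix_inv_decay` — `|P⁻¹((x,a),(y,a'))| ≤ (g²/b₀)(2d/(2d+b₀))^n` for `x_{i₀} − y_{i₀}` `n`-far,
  UNIFORMLY in the period `N` and in `ε ≥ 0` (the columns of `P⁻¹` are the vector Green's functions
  of `debyeGreen_decay`);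
* `dhGaussian_covariance` — `e^{−½φᵀPφ}` is integrable with positive integral and
  `∫ φ_p φ_q e^{−½φᵀPφ} / ∫ e^{−½φᵀPφ} = P⁻¹(p,q)`: the normalised measure is Mathlib's
  `multivariateGaussian 0 P⁻¹` transported along `WithLp.ofLp`
  (`GaussianToolkit.multivariateGaussian_inv_eq_withDensity`, `covariance_eval_multivariateGaussian`).
-/

set_option autoImplicit false

noncomputable section

namespace Summit.QuantumFields.YangMills.Theorems.AnchorGap

open MeasureTheory Finset Matrix
open Literature.Probability.LatticeModels

/-- **Action of the Debye–Hückel precision matrix.** The matrix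
`P = g⁻²[(−Δ_N + ε) ⊗ 1 + 1 ⊗ B]` on `(ℤ/N)^d × Fin k` (entries written out with Kronecker deltas)
acts on a configuration by `(Pφ)(x,a) = g⁻²[(ε + 2d) φ(x,a) + Σ_{a'} B_{aa'} φ(x,a') − Σ_i (φ(x+eᵢ,a) + φ(x−eᵢ,a))]`.
[folklore] -/
theorem dhMatrix_mulVec :
    ∀ (d N k : ℕ) [NeZero N] (g ε : ℝ) (B : Fin k → Fin k → ℝ) (φ : LatticeSineGordon.Config d N k) (p : TorusSite d N × Fin k), (Matrix.of (fun p q : TorusSite d N × Fin k => (g ^ 2)⁻¹ * ((if p.1 = q.1 then (if p.2 = q.2 then ε + 2 * (d : ℝ) else 0) + B p.2 q.2 else 0) - (if p.2 = q.2 then ∑ i : Fin d, ((if q.1 = p.1 + Pi.single i 1 then (1 : ℝ) else 0) + (if q.1 = p.1 - Pi.single i 1 then (1 : ℝ) else 0)) else 0))) *ᵥ φ) p = (g ^ 2)⁻¹ * ((ε + 2 * d) * φ p + ∑ a' : Fin k, B p.2 a' * φ (p.1, a') - ∑ i : Fin d, (φ (p.1 + Pi.single i 1, p.2) + φ (p.1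 - Pi.single i 1, p.2))) := by
  intro d N k _ g ε B φ p
  classical
  simp only [Matrix.mulVec, dotProduct, Matrix.of_apply]
  simp_rw [mul_assoc]
  rw [← Finset.mul_sum]
  congr 1
  simp only [sub_mul, Finset.sum_sub_distrib]
  congr 1
  · -- diagonal-in-`x` part
    rw [Fintype.sum_prod_type]
    simp only [ite_mul, zero_mul, Finset.sum_ite_irrel, Finset.sum_const_zero, Finset.sum_ite_eq,
      Finset.mem_univ, if_true, add_mul, Finset.sum_add_distrib]
  · -- hopping part
    rw [Fintype.sum_prod_type]
    simp only [ite_mul, zero_mul, sum_ite_eq, mem_univ, ↓reduceIte]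
    simp_rw [Finset.sum_mul]
    rw [Finset.sum_comm]
    refine Finset.sum_congr rfl fun i _ => ?_
    simp only [add_mul, Finset.sum_add_distrib, ite_mul, one_mul, zero_mul, sum_ite_eq', mem_univ, ↓reduceIte]


/-- **The Debye–Hückel quadratic form.** `φᵀ P φ = 2 S_Gauss(φ) + g⁻² Σ_x φ_xᵀ B φ_x`: half the
form of the precision matrix `P = g⁻²[(−Δ_N + ε) ⊗ 1 + 1 ⊗ B]` is the Gaussian action plus the
sitewise mass term (for `B = 2ζg² Σ_r α_r α_rᵀ` this is the quadratic part of `−tilt` around the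
sector minimum: the Debye–Hückel action). [folklore] -/
theorem dhMatrix_form :
    ∀ (d N k : ℕ) [NeZero N] (g ε : ℝ) (B : Fin k → Fin k → ℝ) (φ : LatticeSineGordon.Config d N k), φ ⬝ᵥ (Matrix.of (fun p q : TorusSite d N × Fin k => (g ^ 2)⁻¹ * ((if p.1 = q.1 then (if p.2 = q.2 then ε + 2 * (d : ℝ) else 0) + B p.2 q.2 else 0) - (if p.2 = q.2 then ∑ i : Fin d, ((if q.1 = p.1 + Pi.single i 1 then (1 : ℝ) else 0) + (if q.1 = p.1 - Pi.single i 1 then (1 : ℝ) else 0)) else 0))) *ᵥ φ) = 2 * LatticeSineGordon.gaussianAction g ε φ + (g ^ 2)⁻¹ * ∑ x : TorusSite d N, ∑ a : Fin k, ∑ a' : Fin k, φ (x, a) * B a a' * φ (x, a') := by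
  intro d N k _ g ε B φ
  rw [dotProduct, gaussianAction_eq_quadraticForm d N k g ε φ]
  simp_rw [dhMatrix_mulVec d N k g ε B φ]
  have hsplit : ∀ p : TorusSite d N × Fin k, φ p * ((g ^ 2)⁻¹ * ((ε + 2 * d) * φ p +
      ∑ a' : Fin k, B p.2 a' * φ (p.1, a') - ∑ i : Fin d, (φ (p.1 + Pi.single i 1, p.2) + φ (p.1 - Pi.single i 1, p.2)))) =
      (g ^ 2)⁻¹ * (φ p * ((ε + 2 * d) * φ p - ∑ i : Fin d, (φ (p.1 + Pi.single i 1, p.2) + φ (p.1 - Pi.single i 1, p.2)))) +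
        (g ^ 2)⁻¹ * (φ p * ∑ a' : Fin k, B p.2 a' * φ (p.1, a')) := by
    intro p
    ring
  simp_rw [hsplit]
  rw [Finset.sum_add_distrib, ← Finset.mul_sum, ← Finset.mul_sum]
  have hB' : ∑ p : TorusSite d N × Fin k, φ p * ∑ a' : Fin k, B p.2 a' * φ (p.1, a') =
      ∑ x : TorusSite d N, ∑ a : Fin k, ∑ a' : Fin k, φ (x, a) * B a a' * φ (x, a') := by
    rw [Fintype.sum_prod_type]
    refine Finset.sum_congr rfl fun x _ => Finset.sum_congr rfl fun a _ => ?_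
    rw [Finset.mul_sum]
    exact Finset.sum_congr rfl fun a' _ => by ring
  rw [hB']
  ring

/-- **The Debye–Hückel precision matrix is positive definite** for `g ≠ 0`, `ε ≥ 0` and a symmetric
mass matrix `B` with `wᵀBw ≥ b₀|w|²`, `b₀ > 0`: symmetry of the nearest-neighbour Laplacian and
`φᵀPφ ≥ g⁻² b₀ |φ|²` (`debyeOp_coercive`). [folklore] -/
theorem dhMatrix_posDef :
    ∀ (d N k : ℕ) [NeZero N] (g ε b₀ : ℝ), g ≠ 0 → 0 ≤ ε → 0 < b₀ → ∀ (B : Fin k → Fin k → ℝ), (∀ a a' : Fin k, B a a' = B a' a) → (∀ w : Fin k → ℝ, b₀ * ∑ a : Fin k, w a ^ 2 ≤ ∑ a : Fin k, ∑ a' : Fin k, w a * B a a' * w a') → (Matrix.of (fun p q : TorusSite d N × Fin k => (g ^ 2)⁻¹ * ((if p.1 = q.1 then (if p.2 = q.2 then ε + 2 * (d : ℝ) else 0) + B p.2 q.2 else 0) - (if p.2 = q.2 then ∑ i : Fin d, ((if q.1 = p.1 + Pi.single i 1 then (1 : ℝ) else 0) + (if q.1 = p.1 - Pi.single i 1 then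 (1 : ℝ) else 0)) else 0)))).PosDef := by
  intro d N k _ g ε b₀ hg hε hb₀ B hBsymm hB
  classical
  refine Matrix.PosDef.of_dotProduct_mulVec_pos ?_ ?_
  · -- symmetry
    refine Matrix.IsHermitian.ext fun p q => ?_
    simp only [star_trivial, Matrix.of_apply]
    congr 1
    congr 1
    · by_cases h1 : q.1 = p.1
      · rw [if_pos h1, if_pos h1.symm, hBsymm q.2 p.2]
        by_cases h2 : q.2 = p.2
        · rw [if_pos h2, if_pos h2.symm]
        · rw [if_neg h2, if_neg (Ne.symm h2)]
      · rw [if_neg h1, if_neg (Ne.symm h1)]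
    · by_cases h2 : q.2 = p.2
      · rw [if_pos h2, if_pos h2.symm]
        refine Finset.sum_congr rfl fun i _ => ?_
        have e1 : (p.1 = q.1 + Pi.single i 1) ↔ (q.1 = p.1 - Pi.single i 1) := by
          constructor <;> intro h <;> rw [h] <;> abel
        have e2 : (p.1 = q.1 - Pi.single i 1) ↔ (q.1 = p.1 + Pi.single i 1) := by
          constructor <;> intro h <;> rw [h] <;> abel
        rw [add_comm]
        congr 1
        · exact if_congr e2 rfl rfl
        · exact if_congr e1 rfl rfl
      · rw [if_neg h2, if_neg (Ne.symm h2)]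
  · -- positivity
    intro φ hφ
    simp only [star_trivial]
    have hform := dhMatrix_form d N k g ε B φ
    have hcoer := debyeOp_coercive d N k ε b₀ hε B hB (fun x a => φ (x, a))
    have hquad := gaussianAction_eq_quadraticForm d N k g ε φ
    have hg2 : 0 < g ^ 2 := lt_of_le_of_ne (sq_nonneg g) (Ne.symm (pow_ne_zero 2 hg))
    -- `φᵀPφ = g⁻² ⟨u, L u⟩`
    have hPL : φ ⬝ᵥ (Matrix.of (fun p q : TorusSite d N × Fin k => (g ^ 2)⁻¹ * ((if p.1 = q.1 then (if p.2 = q.2 then ε + 2 * (d : ℝ) else 0) + B p.2 q.2 else 0) - (if p.2 = q.2 then ∑ i : Fin d, ((if q.1 = p.1 + Pi.single i 1 then (1 : ℝ) else 0) + (if q.1 = p.1 - Pi.single i 1 then (1 : ℝ) else 0)) else 0))) *ᵥ φ) = (g ^ 2)⁻¹ * ∑ x : TorusSite d N, ∑ a : Fin k, φ (x, a) *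
        ((ε + 2 * d) * φ (x, a) + ∑ a' : Fin k, B a a' * φ (x, a') -
          ∑ i : Fin d, (φ (x + Pi.single i 1, a) + φ (x - Pi.single i 1, a))) := by
      rw [dotProduct]
      simp_rw [dhMatrix_mulVec d N k g ε B φ]
      rw [Finset.mul_sum, Fintype.sum_prod_type]
      refine Finset.sum_congr rfl fun x _ => ?_
      rw [Finset.mul_sum]
      refine Finset.sum_congr rfl fun a _ => ?_
      ring
    rw [hPL]
    have hpos : 0 < ∑ x : TorusSite d N, ∑ a : Fin k, φ (x, a) ^ 2 := by
      rw [← Fintype.sum_prod_type (fun p : TorusSite d N × Fin k => φ p ^ 2)]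
      obtain ⟨p, hp⟩ : ∃ p, φ p ≠ 0 := Function.ne_iff.1 hφ
      exact lt_of_lt_of_le (by positivity : 0 < φ p ^ 2)
        (Finset.single_le_sum (f := fun q => φ q ^ 2) (fun q _ => sq_nonneg _) (Finset.mem_univ p))
    have : 0 < ∑ x : TorusSite d N, ∑ a : Fin k, φ (x, a) *
        ((ε + 2 * d) * φ (x, a) + ∑ a' : Fin k, B a a' * φ (x, a') -
          ∑ i : Fin d, (φ (x + Pi.single i 1, a) + φ (x - Pi.single i 1, a))) :=
      lt_of_lt_of_le (mul_pos hb₀ hpos) hcoer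
    positivity

/-- **Exponential decay of the Debye–Hückel covariance.** For `g ≠ 0`, `ε ≥ 0` and a symmetric
coercive mass matrix (`wᵀBw ≥ b₀|w|²`, `b₀ > 0`), the inverse of the precision matrix
`P = g⁻²[(−Δ_N + ε) ⊗ 1 + 1 ⊗ B]` — the covariance of the Debye–Hückel Gaussian — satisfies
`|P⁻¹((x,a),(y,a'))| ≤ (g²/b₀) (2d/(2d+b₀))^n` whenever `x_{i₀} − y_{i₀} ∉ {[z] : |z| < n}`, uniformly
in the period `N` and in `ε ≥ 0`: the column `(y,a')` of `P⁻¹` is `g²` times the vector Green's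
function of `debyeGreen_decay`. [folklore] -/
theorem dhMatrix_inv_decay :
    ∀ (d N k : ℕ) [NeZero N] (g ε b₀ : ℝ), g ≠ 0 → 0 ≤ ε → 0 < b₀ → ∀ (B : Fin k → Fin k → ℝ), (∀ a a' : Fin k, B a a' = B a' a) → (∀ w : Fin k → ℝ, b₀ * ∑ a : Fin k, w a ^ 2 ≤ ∑ a : Fin k, ∑ a' : Fin k, w a * B a a' * w a') → ∀ (i₀ : Fin d) (n : ℕ) (x y : TorusSite d N) (a a' : Fin k), (∀ z : ℤ, |z| < n → x i₀ - y i₀ ≠ (z : ZMod N)) → |(Matrix.of (fun p q : TorusSite d N × Fin k => (g ^ 2)⁻¹ * ((if p.1 = q.1 then (if p.2 = q.2 then ε + 2 * (d : ℝ) else 0) + B p.2 q.2 else 0) - (if p.2 = q.2 then ∑ i : Fin d, ((if q.1 = p.1 + Pi.single i 1 then (1 : ℝ) else 0) + (if q.1 = p.1 - Pi.single i 1 then (1 : ℝ) else 0)) else 0))))⁻¹ (x, a) (y, a')| ≤ g ^ 2 / b₀ * (2 * d / (2 * d + b₀)) ^ n := by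
  intro d N k _ g ε b₀ hg hε hb₀ B hBsymm hB i₀ n x y a a' hfar
  classical
  set P : Matrix (TorusSite d N × Fin k) (TorusSite d N × Fin k) ℝ := Matrix.of (fun p q : TorusSite d N × Fin k => (g ^ 2)⁻¹ * ((if p.1 = q.1 then (if p.2 = q.2 then ε + 2 * (d : ℝ) else 0) + B p.2 q.2 else 0) - (if p.2 = q.2 then ∑ i : Fin d, ((if q.1 = p.1 + Pi.single i 1 then (1 : ℝ) else 0) + (if q.1 = p.1 - Pi.single i 1 then (1 : ℝ) else 0)) else 0))) with hPdef
  have hP : P.PosDef := dhMatrix_posDef d N k g ε b₀ hg hε hb₀ B hBsymm hB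
  have hg2 : 0 < g ^ 2 := lt_of_le_of_ne (sq_nonneg g) (Ne.symm (pow_ne_zero 2 hg))
  -- the column `(y, a')` of `P⁻¹`
  set u : TorusSite d N → Fin k → ℝ := fun x₁ a₁ => P⁻¹ (x₁, a₁) (y, a') with hu
  have hcol : P *ᵥ (fun q => P⁻¹ q (y, a')) = fun p => if p = (y, a') then 1 else 0 := by
    have hmul : P * P⁻¹ = 1 := Matrix.mul_nonsing_inv P
      ((Matrix.isUnit_iff_isUnit_det P).1 hP.isUnit)
    funext p
    have := congrFun (congrFun hmul p) (y, a')
    rw [Matrix.mul_apply, Matrix.one_apply] at this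
    rw [← this, Matrix.mulVec, dotProduct]
  -- hence `L u = δ_y ⊗ (g² e_{a'})`
  have hL : ∀ (x₁ : TorusSite d N) (a₁ : Fin k), (ε + 2 * d) * u x₁ a₁ + ∑ a₂ : Fin k, B a₁ a₂ * u x₁ a₂ -
      ∑ i : Fin d, (u (x₁ + Pi.single i 1) a₁ + u (x₁ - Pi.single i 1) a₁) =
        if x₁ = y then (fun a₂ : Fin k => if a₂ = a' then g ^ 2 else 0) a₁ else 0 := by
    intro x₁ a₁
    have h1 := congrFun hcol (x₁, a₁)
    rw [hPdef, dhMatrix_mulVec d N k g ε B (fun q => P⁻¹ q (y, a')) (x₁, a₁)] at h1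
    simp only [hu]
    have h2 : (ε + 2 * d) * P⁻¹ (x₁, a₁) (y, a') + ∑ a₂ : Fin k, B a₁ a₂ * P⁻¹ (x₁, a₂) (y, a') -
        ∑ i : Fin d, (P⁻¹ (x₁ + Pi.single i 1, a₁) (y, a') + P⁻¹ (x₁ - Pi.single i 1, a₁) (y, a')) =
        g ^ 2 * (if ((x₁, a₁) : TorusSite d N × Fin k) = (y, a') then 1 else 0) := by
      rw [← h1]
      field_simp
    rw [h2]
    by_cases hx : x₁ = y
    · by_cases ha : a₁ = a'
      · simp [hx, ha]
      · simp [hx, ha]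
    · have : ((x₁, a₁) : TorusSite d N × Fin k) ≠ (y, a') := fun h => hx (Prod.mk.inj h).1
      simp [hx, this]
  have hdec := debyeGreen_decay d N k ε b₀ hε hb₀ B hB y (fun a₂ => if a₂ = a' then g ^ 2 else 0) u hL i₀ n x hfar
  have hv : ∑ a₂ : Fin k, (if a₂ = a' then g ^ 2 else (0 : ℝ)) ^ 2 = (g ^ 2) ^ 2 := by
    simp [Finset.sum_ite_eq', apply_ite (· ^ 2)]
  rw [hv] at hdec
  have hsingle : u x a ^ 2 ≤ ∑ a₂ : Fin k, u x a₂ ^ 2 :=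
    Finset.single_le_sum (f := fun a₂ => u x a₂ ^ 2) (fun _ _ => sq_nonneg _) (Finset.mem_univ a)
  have hθ : 0 ≤ (2 * d / (2 * d + b₀) : ℝ) := by positivity
  have hbound : u x a ^ 2 ≤ (g ^ 2 / b₀ * (2 * d / (2 * d + b₀)) ^ n) ^ 2 := by
    calc u x a ^ 2 ≤ (g ^ 2) ^ 2 / b₀ ^ 2 * ((2 * d / (2 * d + b₀)) ^ 2) ^ n := hsingle.trans hdec
      _ = (g ^ 2 / b₀ * (2 * d / (2 * d + b₀)) ^ n) ^ 2 := by
          rw [pow_right_comm (2 * (d : ℝ) / (2 * d + b₀)) 2 n]; ring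
  have hnn : 0 ≤ g ^ 2 / b₀ * (2 * d / (2 * d + b₀)) ^ n := by positivity
  show |u x a| ≤ _
  exact abs_le.2 (abs_le_of_sq_le_sq' hbound hnn)


open Literature.MathematicalPhysics.QuantumFieldTheory ProbabilityTheory in
/-- **The Debye–Hückel Gaussian and its covariance.** For `g ≠ 0`, `ε ≥ 0` and a symmetric coercive
mass matrix `B`, the weight `e^{−½ φᵀPφ}` of the precision matrix `P = g⁻²[(−Δ_N + ε) ⊗ 1 + 1 ⊗ B]`
is Lebesgue integrable on configurations with positive integral, and the normalised measure has
second moments `∫ φ_p φ_q e^{−½φᵀPφ} dφ / ∫ e^{−½φᵀPφ} dφ = P⁻¹(p,q)`: it is Mathlib's centred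
multivariate Gaussian `N(0, P⁻¹)` transported along `WithLp.ofLp`
(`GaussianToolkit.multivariateGaussian_inv_eq_withDensity`, `covariance_eval_multivariateGaussian`).
With `dhMatrix_inv_decay` this is the exponentially decaying Debye–Hückel reference covariance,
uniformly in the period. [folklore] -/
theorem dhGaussian_covariance :
    ∀ (d N k : ℕ) [NeZero N] (g ε b₀ : ℝ), g ≠ 0 → 0 ≤ ε → 0 < b₀ → ∀ (B : Fin k → Fin k → ℝ), (∀ a a' : Fin k, B a a' = B a' a) → (∀ w : Fin k → ℝ, b₀ * ∑ a : Fin k, w a ^ 2 ≤ ∑ a : Fin k, ∑ a' : Fin k, w a * B a a' * w a') → Integrable (fun φ : LatticeSineGordon.Config d N k => Real.exp (-(φ ⬝ᵥ (Matrix.of (fun p q : TorusSite d N × Fin k => (g ^ 2)⁻¹ * ((if p.1 = q.1 then (if p.2 = q.2 then ε + 2 * (d : ℝ) else 0) + B p.2 q.2 else 0) - (if p.2 = q.2 then ∑ i : Fin d, ((if q.1 = p.1 + Pi.single i 1 then (1 : ℝ) else 0) + (if q.1 = p.1 - Pi.single i 1 then (1 : ℝ) else 0)) else 0))) *ᵥ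 φ)) / 2)) ∧ 0 < ∫ φ : LatticeSineGordon.Config d N k, Real.exp (-(φ ⬝ᵥ (Matrix.of (fun p q : TorusSite d N × Fin k => (g ^ 2)⁻¹ * ((if p.1 = q.1 then (if p.2 = q.2 then ε + 2 * (d : ℝ) else 0) + B p.2 q.2 else 0) - (if p.2 = q.2 then ∑ i : Fin d, ((if q.1 = p.1 + Pi.single i 1 then (1 : ℝ) else 0) + (if q.1 = p.1 - Pi.single i 1 then (1 : ℝ) else 0)) else 0))) *ᵥ φ)) / 2) ∧ ∀ p q : TorusSite d N × Fin k, (∫ φ : LatticeSineGordon.Config d N k, φ p * φ q * Real.exp (-(φ ⬝ᵥ (Matrix.of (fun p q : TorusSite d N × Fin k => (g ^ 2)⁻¹ * ((if p.1 = q.1 then (if p.2 = q.2 then ε + 2 * (d : ℝ) else 0) + B p.2 q.2 else 0) - (if p.2 = q.2 then ∑ i : Fin d, ((if q.1 = p.1 + Pi.single i 1 then (1 : ℝ) else 0) + (if q.1 = p.1 - Pi.single i 1 then (1 : ℝ) else 0)) else 0))) *ᵥ φ)) / 2)) / (∫ φ : LatticeSineGordon.Config d N k, Real.exp (-(φ ⬝ᵥ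 (Matrix.of (fun p q : TorusSite d N × Fin k => (g ^ 2)⁻¹ * ((if p.1 = q.1 then (if p.2 = q.2 then ε + 2 * (d : ℝ) else 0) + B p.2 q.2 else 0) - (if p.2 = q.2 then ∑ i : Fin d, ((if q.1 = p.1 + Pi.single i 1 then (1 : ℝ) else 0) + (if q.1 = p.1 - Pi.single i 1 then (1 : ℝ) else 0)) else 0))) *ᵥ φ)) / 2)) = (Matrix.of (fun p q : TorusSite d N × Fin k => (g ^ 2)⁻¹ * ((if p.1 = q.1 then (if p.2 = q.2 then ε + 2 * (d : ℝ) else 0) + B p.2 q.2 else 0) - (if p.2 = q.2 then ∑ i : Fin d, ((if q.1 = p.1 + Pi.single i 1 then (1 : ℝ) else 0) + (if q.1 = p.1 - Pi.single i 1 then (1 : ℝ) else 0)) else 0))))⁻¹ p q := by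
  intro d N k _ g ε b₀ hg hε hb₀ B hBsymm hB
  classical
  set P : Matrix (TorusSite d N × Fin k) (TorusSite d N × Fin k) ℝ := Matrix.of (fun p q : TorusSite d N × Fin k => (g ^ 2)⁻¹ * ((if p.1 = q.1 then (if p.2 = q.2 then ε + 2 * (d : ℝ) else 0) + B p.2 q.2 else 0) - (if p.2 = q.2 then ∑ i : Fin d, ((if q.1 = p.1 + Pi.single i 1 then (1 : ℝ) else 0) + (if q.1 = p.1 - Pi.single i 1 then (1 : ℝ) else 0)) else 0))) with hPdef
  have hP : P.PosDef := dhMatrix_posDef d N k g ε b₀ hg hε hb₀ B hBsymm hB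
  obtain ⟨hρ, hZ0, hZtop⟩ := GaussianToolkit.multivariateGaussian_inv_eq_withDensity hP
  -- the weight along `toLp`, and the partition function as an integral over configurations
  have hw : ∀ φ : LatticeSineGordon.Config d N k, GaussianToolkit.gaussWeight P (WithLp.toLp 2 φ) =
      ENNReal.ofReal (Real.exp (-(φ ⬝ᵥ (P *ᵥ φ)) / 2)) := fun φ => by
    rw [GaussianToolkit.gaussWeight, WithLp.ofLp_toLp]
  have hmeas : Measurable (fun φ : LatticeSineGordon.Config d N k => Real.exp (-(φ ⬝ᵥ (P *ᵥ φ)) / 2)) := by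
    have : Continuous (fun φ : LatticeSineGordon.Config d N k => Real.exp (-(φ ⬝ᵥ (P *ᵥ φ)) / 2)) := by
      refine Real.continuous_exp.comp ((Continuous.neg ?_).div_const _)
      exact continuous_id.dotProduct (Continuous.matrix_mulVec continuous_const continuous_id)
    exact this.measurable
  have hnn : ∀ φ : LatticeSineGordon.Config d N k, 0 ≤ Real.exp (-(φ ⬝ᵥ (P *ᵥ φ)) / 2) := fun φ =>
    (Real.exp_pos _).le
  have hZ : GaussianToolkit.gaussZ P =
      ∫⁻ φ : LatticeSineGordon.Config d N k, ENNReal.ofReal (Real.exp (-(φ ⬝ᵥ (P *ᵥ φ)) / 2)) := by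
    rw [GaussianToolkit.gaussZ, ← (PiLp.volume_preserving_toLp (TorusSite d N × Fin k)).lintegral_comp
      (GaussianToolkit.measurable_gaussWeight _)]
    simp_rw [hw]
  have hint : Integrable (fun φ : LatticeSineGordon.Config d N k => Real.exp (-(φ ⬝ᵥ (P *ᵥ φ)) / 2)) := by
    refine (lintegral_ofReal_ne_top_iff_integrable hmeas.aestronglyMeasurable
      (Filter.Eventually.of_forall hnn)).1 ?_
    rw [← hZ]; exact hZtop
  have hZreal : ENNReal.ofReal (∫ φ : LatticeSineGordon.Config d N k, Real.exp (-(φ ⬝ᵥ (P *ᵥ φ)) / 2)) =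
      GaussianToolkit.gaussZ P := by
    rw [ofReal_integral_eq_lintegral_ofReal hint (Filter.Eventually.of_forall hnn), hZ]
  have hZpos : 0 < ∫ φ : LatticeSineGordon.Config d N k, Real.exp (-(φ ⬝ᵥ (P *ᵥ φ)) / 2) := by
    have h0 : 0 ≤ ∫ φ : LatticeSineGordon.Config d N k, Real.exp (-(φ ⬝ᵥ (P *ᵥ φ)) / 2) :=
      integral_nonneg hnn
    rcases h0.lt_or_eq with h | h
    · exact h
    · exact absurd (show GaussianToolkit.gaussZ P = 0 by rw [← hZreal, ← h, ENNReal.ofReal_zero]) hZ0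
  refine ⟨hint, hZpos, fun p q => ?_⟩
  -- transport of integrals from `N(0, P⁻¹)` to configurations
  have htrans : ∀ F : LatticeSineGordon.Config d N k → ℝ,
      ∫ x, F (WithLp.ofLp x) ∂(multivariateGaussian 0 P⁻¹) =
        (∫ φ : LatticeSineGordon.Config d N k, Real.exp (-(φ ⬝ᵥ (P *ᵥ φ)) / 2))⁻¹ *
        ∫ φ : LatticeSineGordon.Config d N k, F φ * Real.exp (-(φ ⬝ᵥ (P *ᵥ φ)) / 2) := by
    intro F
    rw [hρ, integral_smul_measure, integral_withDensity_eq_integral_toReal_smul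
      (GaussianToolkit.measurable_gaussWeight _) (Filter.Eventually.of_forall fun _ => by
        rw [GaussianToolkit.gaussWeight]; exact ENNReal.ofReal_lt_top)]
    have hcomp := (PiLp.volume_preserving_toLp (TorusSite d N × Fin k)).integral_comp'
      (f := MeasurableEquiv.toLp 2 (LatticeSineGordon.Config d N k))
      (fun x : EuclideanSpace ℝ (TorusSite d N × Fin k) => (GaussianToolkit.gaussWeight P x).toReal • F (WithLp.ofLp x))
    rw [← hcomp]
    simp only [MeasurableEquiv.toLp_apply, hw, WithLp.ofLp_toLp, smul_eq_mul]
    rw [ENNReal.toReal_inv, ← hZreal, ENNReal.toReal_ofReal hZpos.le]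
    congr 1
    refine integral_congr_ae (Filter.Eventually.of_forall fun φ => ?_)
    simp only []
    rw [ENNReal.toReal_ofReal (hnn φ), mul_comm]
  -- second moments of `N(0, P⁻¹)`
  have hS : P⁻¹.PosSemidef := hP.inv.posSemidef
  have hmem : ∀ r : TorusSite d N × Fin k, MemLp (fun x : EuclideanSpace ℝ (TorusSite d N × Fin k) => x.ofLp r) 2
      (multivariateGaussian 0 P⁻¹) := fun r => by
    have h := (ProbabilityTheory.IsGaussian.memLp_two_id (μ := multivariateGaussian 0 P⁻¹))
    have := (EuclideanSpace.proj (𝕜 := ℝ) r).comp_memLp' h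
    simpa using this
  have hmean : ∀ r : TorusSite d N × Fin k,
      ∫ x : EuclideanSpace ℝ (TorusSite d N × Fin k), x.ofLp r ∂(multivariateGaussian 0 P⁻¹) = 0 := fun r => by
    have hmp := ProbabilityTheory.measurePreserving_eval_multivariateGaussian (μ := 0) hS (i := r)
    have h1 := integral_map (μ := multivariateGaussian 0 P⁻¹)
      (φ := fun x : EuclideanSpace ℝ (TorusSite d N × Fin k) => x.ofLp r)
      hmp.measurable.aemeasurable (f := fun t : ℝ => t) aestronglyMeasurable_id
    rw [hmp.map_eq] at h1
    rw [← h1]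
    simp [integral_id_gaussianReal]
  have hcov := covariance_eval_multivariateGaussian (μ := (0 : EuclideanSpace ℝ (TorusSite d N × Fin k))) hS p q
  rw [covariance_eq_sub (hmem p) (hmem q), hmean p, hmean q, zero_mul, sub_zero] at hcov
  have hF := htrans (fun φ => φ p * φ q)
  rw [div_eq_inv_mul, ← hF, ← hcov]
  rfl

end Summit.QuantumFields.YangMills.Theorems.AnchorGap

end
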